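import Mathlib.Analysis.Fourier.FiniteAbelian.PontryaginDuality
import Mathlib.RingTheory.RootsOfUnity.PrimitiveRoots
import HarnessLib

/-!
# Schur–Fejér splitting §8d: generation by duality in `Π i, ZMod (n i)`

`exists_exponents_pi`: if `ω_i` are primitive `n_i`-th roots of unity and a finite set `L` of labels in the box `Π_i [0,n_i)` annihilates no
non-zero `m` in the box (`∀ m ≠ 0, ∃ l ∈ L, Π_i (ω_i^{l_i})^{m_i} ≠ 1`), then every target `t : ι → ℕ` is `Σ_{l ∈ L} f(l) • l ≡ t` coordinatewise
mod `n_i`.  Proof: the labels generate `Π i, ZMod (n i)` — otherwise `AddChar.exists_apply_ne_zero` gives a non-trivial character of the quotient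
by their span, i.e. (via `IsPrimitiveRoot.eq_pow_of_pow_eq_one` on the basis vectors `Pi.single i 1` and `addChar_map_sum`) a non-zero `m` in
the box annihilated by `L`; finiteness turns subgroup closure into monoid closure (`card_nsmul_eq_zero`, `AddSubmonoid.mem_closure_finset`).
Pure Mathlib content, kept in the Schur–Fejér namespace for its one consumer (`…SchurFejerFiniteCentralKer`).

HONEST LABEL.  The Yang–Mills mass gap (Clay) is NOT proved; `IRcof` ∕ `IR` are 0 ∕ 1 proved; this is finite-dimensional representation
theory toward ONE stub (S2ᵛ `EquipartitionSeam.SplitVanishing`) of census row 47 (mechanism 0, transported; class PWP); nothing continuum ∕ OS ∕ Clay.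
Source: ideator `ym-ir-idea-22` g4, Lines core `Cruxes/IRcof/Lines/equipartition_seam_SchurFejerCore.lean` rev 11 (crux write 80e9377d57ba), verbatim.
-/

set_option autoImplicit false

noncomputable section

open Finset Complex

namespace Summit.QuantumFields.YangMills.Cruxes.IRcof.EquipartitionSeam.SchurFejer

open scoped ComplexOrder Matrix

section GenerationPi

/-- `AddChar` of a finite sum is the product. -/
theorem addChar_map_sum {A M ι' : Type} [AddCommMonoid A] [CommMonoid M] (ψ : AddChar A M)
    (s : Finset ι') (g : ι' → A) : ψ (∑ i ∈ s, g i) = ∏ i ∈ s, ψ (g i) := by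
  classical
  induction s using Finset.induction_on with
  | empty => rw [Finset.sum_empty, Finset.prod_empty, AddChar.map_zero_eq_one]
  | insert a s ha ih => rw [Finset.sum_insert ha, Finset.prod_insert ha, AddChar.map_add_eq_mul, ih]

/-- THE EXPONENT CHOICE in `Π_i ZMod n_i` from finite-abelian duality: if no `m ≠ 0` in the box kills every label in `L`,
the labels generate, and every target `t` is a non-negative combination `Σ_{l ∈ L} f(l) l ≡ t`. -/
theorem exists_exponents_pi {ι : Type} [Fintype ι] [DecidableEq ι] {n : ι → ℕ} (hn : ∀ i, 0 < n i)
    {ω : ι → ℂ} (hω : ∀ i, IsPrimitiveRoot (ω i) (n i)) (L : Finset (ι → ℕ))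
    (hL : ∀ l ∈ L, ∀ i, l i < n i)
    (hgen : ∀ m : ι → ℕ, (∀ i, m i < n i) → (∃ i, m i ≠ 0) → ∃ l ∈ L, ∏ i, (ω i ^ l i) ^ m i ≠ 1)
    (t : ι → ℕ) : ∃ f : (ι → ℕ) → ℕ, ∀ i, (∑ l ∈ L, l i * f l) ≡ t i [MOD n i] := by
  classical
  haveI : ∀ i, NeZero (n i) := fun i => ⟨(hn i).ne'⟩
  set cast : (ι → ℕ) → ((i : ι) → ZMod (n i)) := fun l i => ((l i : ℕ) : ZMod (n i)) with hcast
  set S : Finset ((i : ι) → ZMod (n i)) := L.image cast with hS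
  set B : AddSubgroup ((i : ι) → ZMod (n i)) := AddSubgroup.closure (S : Set ((i : ι) → ZMod (n i)))
    with hBdef
  have hmemB : ∀ l ∈ L, cast l ∈ B := fun l hl =>
    AddSubgroup.subset_closure (Finset.mem_coe.2 (Finset.mem_image_of_mem _ hl))
  have hdecomp : ∀ x : (i : ι) → ZMod (n i), x = ∑ i, (x i).val • Pi.single i (1 : ZMod (n i)) := by
    intro x
    funext j
    rw [Finset.sum_apply, Finset.sum_eq_single j]
    · rw [Pi.smul_apply, Pi.single_eq_same, nsmul_eq_mul, mul_one, ZMod.natCast_zmod_val]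
    · intro b _ hbj
      rw [Pi.smul_apply, Pi.single_eq_of_ne (Ne.symm hbj), smul_zero]
    · intro h
      exact absurd (Finset.mem_univ j) h
  have hB : B = ⊤ := by
    by_contra hne
    obtain ⟨a, ha⟩ : ∃ a, a ∉ B := by
      by_contra hall
      push Not at hall
      exact hne ((AddSubgroup.eq_top_iff' B).2 hall)
    have hq : (QuotientAddGroup.mk' B a) ≠ 0 := by
      rwa [Ne, QuotientAddGroup.mk'_apply, QuotientAddGroup.eq_zero_iff]
    obtain ⟨ψ, hψ⟩ := AddChar.exists_apply_ne_zero.2 hq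
    set χ : AddChar ((i : ι) → ZMod (n i)) ℂ := ψ.compAddMonoidHom (QuotientAddGroup.mk' B) with hχ
    have hχB : ∀ b ∈ B, χ b = 1 := by
      intro b hb
      rw [hχ, AddChar.compAddMonoidHom_apply, QuotientAddGroup.mk'_apply,
        (QuotientAddGroup.eq_zero_iff b).2 hb, AddChar.map_zero_eq_one]
    have hχa : χ a ≠ 1 := by
      rw [hχ, AddChar.compAddMonoidHom_apply]
      exact hψ
    have hζ : ∀ i, χ (Pi.single i 1) ^ n i = 1 := by
      intro i
      rw [← AddChar.map_nsmul_eq_pow]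
      have : n i • Pi.single i (1 : ZMod (n i)) = (0 : (i : ι) → ZMod (n i)) := by
        funext j
        by_cases hj : j = i
        · subst hj
          rw [Pi.smul_apply, Pi.single_eq_same, Pi.zero_apply, nsmul_eq_mul, mul_one, ZMod.natCast_self]
        · rw [Pi.smul_apply, Pi.single_eq_of_ne hj, smul_zero, Pi.zero_apply]
      rw [this, AddChar.map_zero_eq_one]
    have hm : ∀ i, ∃ mi : ℕ, mi < n i ∧ ω i ^ mi = χ (Pi.single i 1) := by
      intro i
      obtain ⟨mi, h1, h2⟩ := (hω i).eq_pow_of_pow_eq_one (hζ i)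
      exact ⟨mi, h1, h2⟩
    choose m hmlt hme using hm
    have hχval : ∀ x : (i : ι) → ZMod (n i), χ x = ∏ i, ω i ^ (m i * (x i).val) := by
      intro x
      conv_lhs => rw [hdecomp x]
      rw [addChar_map_sum]
      refine Finset.prod_congr rfl fun i _ => ?_
      rw [AddChar.map_nsmul_eq_pow, ← hme, ← pow_mul]
    have hkill : ∀ l ∈ L, ∏ i, (ω i ^ l i) ^ m i = 1 := by
      intro l hl
      have h := hχB (cast l) (hmemB l hl)
      rw [hχval] at h
      rw [← h]
      refine Finset.prod_congr rfl fun i _ => ?_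
      have hv : (cast l i).val = l i := by
        simp only [hcast, ZMod.val_natCast, Nat.mod_eq_of_lt (hL l hl i)]
      rw [hv, ← pow_mul, mul_comm]
    have hm0 : ∀ i, m i = 0 := by
      by_contra h
      push Not at h
      obtain ⟨l, hl, hne1⟩ := hgen m hmlt h
      exact hne1 (hkill l hl)
    apply hχa
    rw [hχval]
    exact Finset.prod_eq_one fun i _ => by rw [hm0 i, zero_mul, pow_zero]
  -- the target lies in `B = ⊤`, hence in the additive MONOID generated by `S` (finite group)
  have hT : (fun i => ((t i : ℕ) : ZMod (n i))) ∈
      AddSubmonoid.closure (S : Set ((i : ι) → ZMod (n i))) := by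
    have h' : (fun i => ((t i : ℕ) : ZMod (n i))) ∈ B.toAddSubmonoid := by
      rw [hB]; exact AddSubgroup.mem_top _
    rw [hBdef, AddSubgroup.closure_toAddSubmonoid] at h'
    refine (AddSubmonoid.closure_le.2 ?_) h'
    rintro x (hx | hx)
    · exact AddSubmonoid.subset_closure hx
    · have hs : -x ∈ (S : Set ((i : ι) → ZMod (n i))) := by simpa using hx
      set M : ℕ := Fintype.card ((i : ι) → ZMod (n i)) with hM
      have hMpos : 0 < M := Fintype.card_pos
      have hx' : x = (M - 1) • (-x) := by
        have h0 : (M - 1 + 1) • (-x) = 0 := by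
          rw [Nat.sub_add_cancel hMpos, hM, card_nsmul_eq_zero]
        rw [succ_nsmul] at h0
        have := eq_neg_of_add_eq_zero_left h0
        rw [neg_neg] at this
        exact this.symm
      rw [hx']
      exact AddSubmonoid.nsmul_mem _ (AddSubmonoid.subset_closure hs) _
  obtain ⟨f, -, hf⟩ := AddSubmonoid.mem_closure_finset.1 hT
  have hinj : ∀ l ∈ L, ∀ l' ∈ L, cast l = cast l' → l = l' := by
    intro l hl l' hl' h
    funext i
    have h1 := congrArg (fun x => (x i).val) h
    simp only [hcast, ZMod.val_natCast, Nat.mod_eq_of_lt (hL l hl i), Nat.mod_eq_of_lt (hL l' hl' i)] at h1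
    exact h1
  rw [hS, Finset.sum_image hinj] at hf
  refine ⟨fun l => f (cast l), fun i => ?_⟩
  have hi : (((∑ l ∈ L, l i * f (cast l) : ℕ)) : ZMod (n i)) = ((t i : ℕ) : ZMod (n i)) := by
    have this : (∑ c ∈ L, f (cast c) • cast c) i = ((t i : ℕ) : ZMod (n i)) := congrFun hf i
    rw [Finset.sum_apply] at this
    rw [← this, Nat.cast_sum]
    refine Finset.sum_congr rfl fun l _ => ?_
    rw [Pi.smul_apply, Nat.cast_mul, nsmul_eq_mul, mul_comm]
  exact (ZMod.natCast_eq_natCast_iff _ _ _).1 hi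

end GenerationPi

end Summit.QuantumFields.YangMills.Cruxes.IRcof.EquipartitionSeam.SchurFejer
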